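import Summits.BirchSwinnertonDyer.BirchSwinnertonDyer.Theorems.AlignedTransportAtTwoMainConjectureTransportAlignedAtTwoKilfordCopyCrossLevelOldLinesHecke
import Summits.BirchSwinnertonDyer.Rank1Residual.F1Sign2.CopyAlignmentAtTwo
import HarnessLib

/-!
# Crux C1 `MainConjectureTransportAlignedAtTwo` (stmt-BirchSwinnertonDyer-22296), line `birth`, residual (R2) `stub_lamLawKilford`, UNEQUAL conductors:
# THE MOD-2 EIGEN-IDEAL OF THE MULTI-PRIME OLD LINE KILLS ITS HALF-PERIODS — «`θ_F` kills `𝔪_F·J₀(L)[2]`» for `F_Q = Σ_{T⊆Q}(∏T)·ι_{∏T} f` at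
# `L = N₁·∏Q`, `𝔪_F = (2, T_p − a_p(f) (p ∉ Q), U_q − 1 (q ∈ Q))` (width seat att-p3 g18; `--supports 22296`)

THEOREMS ONLY (no `def`, no `sorry`, no named fact). The Hecke half of the row «`θ₁` kills `U^⊥`» for the old-line maps in the kernel letter at the common
level `L` (att-p4 g17 / `…KilfordCopyCrossLevelCommonLevelLetter`): the multi-prime analogue of `…KilfordCopyCrossLevelHecke.oldLine_half_smul_mem`, on top of
`…KilfordCopyCrossLevelOldLinesHecke` (`T_p F_Q = a_p F_Q` off `Q`; `U_q F_Q = F_Q + 2·G`, `G` in the old lattice). The ideal is given by GENERATORS (a typer's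
`𝔪` for the level-`L` carrier is the kernel of the mod-`2` eigencharacter of `F_Q`; it contains these generators). BSD is not proved by this; C1 is not closed by this.

* **`oldLines_half_smul_mem_of_mem_span`** — for every `t` in the ideal of `𝕋_ℤ(L)` generated by `2`, the `T_p − a_p(f)` (`p` prime, `p ∉ Q`) and the
  `T_q − 1` (`q ∈ Q`), and every `y ∈ H₁(X₀(L);ℤ)`: `c·(t•y)(F_Q)/2 ∈ Λ` (`c·Λ_f ⊆ Λ`; `q ∈ Q` odd with `a_q(f)` even, `q ∤ N₁`).

References: Diamond–Shurman 2005 Prop. 5.6.2 [DiamondShurman2005]; Darmon–Diamond–Taylor 1995 §1.3, §4.1 [DarmonDiamondTaylor1995]; Cremona 1997 §2.4,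
§2.10 [CremonaAlgorithms1997].
-/

noncomputable section

-- justification: the `Summit.BirchSwinnertonDyer.BirchSwinnertonDyer.…` path repeats a component (route-file convention)
set_option linter.dupNamespace false
set_option autoImplicit false

open scoped MatrixGroups ModularForm Classical

open CongruenceSubgroup Complex
open Literature.NumberTheory.EllipticCurves Literature.NumberTheory.EllipticCurves.ModularForms
open Summit.BirchSwinnertonDyer.Rank1Residual.F1Sign2
open Summit.BirchSwinnertonDyer.BirchSwinnertonDyer.Theorems.AlignedTransportAtTwoKilfordCopyCrossLevelOldLinesHecke

namespace Summit.BirchSwinnertonDyer.BirchSwinnertonDyer.Theorems.AlignedTransportAtTwoKilfordCopyCrossLevelOldLinesHeckeIdeal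

/-- **`c·y(F_Q) ∈ Λ` for every cycle `y ∈ H₁(X₀(L);ℤ)`** (`F_Q = Σ(∏T)•ι_{∏T} f`, each `c·(∏T)·y(ι_{∏T} f) ∈ Λ`). [cite: CremonaAlgorithms1997, §2.4] -/
theorem mul_apply_oldLines_mem {N₁ L : ℕ} [NeZero N₁] [NeZero L] (Q : Finset ℕ) (hQ : ∀ q ∈ Q, q.Prime) (hL : N₁ * ∏ q ∈ Q, q ∣ L)
    (f : CuspForm (Gamma0 N₁) 2) (F : CuspForm (Gamma0 L) 2)
    (hF : ∀ n : ℕ, cuspCoeff F n = ∑ T ∈ Q.powerset, ((∏ q ∈ T, q : ℕ) : ℂ) * (if (∏ q ∈ T, q) ∣ n then cuspCoeff f (n / ∏ q ∈ T, q) else 0))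
    (Λ : AddSubgroup ℂ) (c : ℂ) (hc : ∀ z ∈ periodLattice f, c * z ∈ Λ)
    {y : Module.Dual ℂ (CuspForm (Gamma0 L) 2)} (hy : y ∈ periodHomology L) : c * y F ∈ Λ := by
  classical
  have hQ0 : ∀ q ∈ Q, q ≠ 0 := fun q hq ↦ (hQ q hq).ne_zero
  have hne : ∀ T ∈ Q.powerset, (∏ q ∈ T, q) ≠ 0 := fun T hT ↦
    Finset.prod_ne_zero_iff.mpr fun q hq ↦ hQ0 q (Finset.mem_powerset.mp hT hq)
  have hdiv : ∀ T ∈ Q.powerset, N₁ * ∏ q ∈ T, q ∣ L := fun T hT ↦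
    (mul_dvd_mul_left N₁ (Finset.prod_dvd_prod_of_subset _ _ _ (Finset.mem_powerset.mp hT))).trans hL
  rw [oldLines_eq_sum Q hQ0 hL f F hF hne hdiv, map_sum, Finset.mul_sum]
  refine AddSubgroup.sum_mem Λ fun T _ ↦ ?_
  haveI : NeZero (∏ q ∈ T.1, q) := ⟨hne T.1 T.2⟩
  rw [map_smul, smul_eq_mul]
  exact mul_mul_apply_iota_mem (hdiv T.1 T.2) f Λ c hc hy

/-- **The mod-`2` eigen-ideal of the multi-prime old line kills its half-periods**: `L = N₁·∏Q` (`Q` odd primes not dividing `N₁` with `a_q(f)` even),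
`f` a Hecke eigenform at level `N₁` with integer coefficients `A`, `F_Q` its `∏Q`-old line, `Λ ⊇ c·Λ_f`. For every `t` in the ideal of `𝕋_ℤ(L)` generated by
`2`, `T_p − A p` (`p` prime, `p ∉ Q`) and `T_q − 1` (`q ∈ Q`), and every `y ∈ H₁(X₀(L);ℤ)`: **`c·(t•y)(F_Q)/2 ∈ Λ`**. (Generators: `(T_p − a_p)F_Q = 0`,
`(U_q − 1)F_Q = 2G` with `c·y(G) ∈ Λ`, `c·y(F_Q) ∈ Λ`; then `𝕋`-linearity, `(rt)•y = t•(r•y)`.) [cite: DiamondShurman2005, Prop. 5.6.2]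
[cite: DarmonDiamondTaylor1995, §1.3 and §4.1] [cite: CremonaAlgorithms1997, §2.10] -/
theorem oldLines_half_smul_mem_of_mem_span {N₁ L : ℕ} [NeZero N₁] [NeZero L] (Q : Finset ℕ) (hQ : ∀ q ∈ Q, q.Prime) (hQN₁ : ∀ q ∈ Q, ¬ q ∣ N₁)
    (hQodd : ∀ q ∈ Q, Odd q) (hL : L = N₁ * ∏ q ∈ Q, q) (f : CuspForm (Gamma0 N₁) 2) (A : ℕ → ℤ) (hA : ∀ n, cuspCoeff f n = A n)
    (hT : ∀ (p : ℕ) (hp : p.Prime), (haveI : NeZero p := ⟨hp.ne_zero⟩; heckeT (Gamma0 N₁) 2 p f) = cuspCoeff f p • f)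
    (hAQ : ∀ q ∈ Q, Even (A q)) (F : CuspForm (Gamma0 L) 2)
    (hF : ∀ n : ℕ, cuspCoeff F n = ∑ T ∈ Q.powerset, ((∏ q ∈ T, q : ℕ) : ℂ) * (if (∏ q ∈ T, q) ∣ n then cuspCoeff f (n / ∏ q ∈ T, q) else 0))
    (Λ : AddSubgroup ℂ) (c : ℂ) (hc : ∀ z ∈ periodLattice f, c * z ∈ Λ)
    {t : HeckeRing0 L 2}
    (ht : t ∈ Ideal.span ({t : HeckeRing0 L 2 | t = 2 ∨ (∃ (p : ℕ) (hp : p.Prime), p ∉ Q ∧ t = HeckeRing0.T L 2 p hp - (A p : HeckeRing0 L 2)) ∨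
      (∃ (q : ℕ) (hq : q ∈ Q), t = HeckeRing0.T L 2 q (hQ q hq) - 1)}))
    (y : periodHomologyHecke L) :
    c * ((t • y : periodHomologyHecke L) : Module.Dual ℂ (CuspForm (Gamma0 L) 2)) F / 2 ∈ Λ := by
  classical
  have hLdvd : N₁ * ∏ q ∈ Q, q ∣ L := by rw [hL]
  -- `p ∉ Q` prime: `p ∣ N₁ ↔ p ∣ L`
  have hpL : ∀ p : ℕ, p.Prime → p ∉ Q → (p ∣ N₁ ↔ p ∣ L) := by
    intro p hp hpQ
    rw [hL]
    refine ⟨fun h ↦ h.mul_right _, fun h ↦ ?_⟩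
    rcases (Nat.Prime.dvd_mul hp).mp h with h | h
    · exact h
    · obtain ⟨q, hq, hpq⟩ := (Prime.dvd_finsetProd_iff hp.prime _).mp h
      exact absurd (((Nat.prime_dvd_prime_iff_eq hp (hQ q hq)).mp hpq) ▸ hq) hpQ
  revert y
  refine Submodule.span_induction ?_ ?_ ?_ ?_ ht
  · -- generators
    rintro s (rfl | ⟨p, hp, hpQ, rfl⟩ | ⟨q, hq, rfl⟩) y
    · -- `s = 2`: `c·(2y)(F)/2 = c·y(F)`
      rw [Submodule.coe_smul, HeckeRing0.smul_dual_apply, map_ofNat, Module.End.ofNat_apply, map_nsmul, nsmul_eq_mul, Nat.cast_ofNat]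
      have h : c * (2 * (y : Module.Dual ℂ (CuspForm (Gamma0 L) 2)) F) / 2 = c * (y : Module.Dual ℂ (CuspForm (Gamma0 L) 2)) F := by ring
      rw [h]
      exact mul_apply_oldLines_mem Q hQ hLdvd f F hF Λ c hc y.2
    · -- `s = T_p − A p`: `(T_p − a_p) F = 0`
      haveI : NeZero p := ⟨hp.ne_zero⟩
      have hTp := heckeT_oldLines_of_not_mem Q hQ hLdvd f F hF hp hpQ (hpL p hp hpQ) (cuspCoeff f p) (hT p hp)
      rw [Submodule.coe_smul, HeckeRing0.smul_dual_apply, map_sub, HeckeRing0.toEnd_T, map_intCast, LinearMap.sub_apply, Module.End.intCast_apply, hTp, hA p,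
        Int.cast_smul_eq_zsmul ℂ, sub_self, map_zero, mul_zero, zero_div]
      exact Λ.zero_mem
    · -- `s = T_q − 1`: `(U_q − 1) F = 2G`
      obtain ⟨G, hG, hGint⟩ := heckeT_oldLines_of_mem Q hQ hQN₁ hL f A hA hT F hF hq (hQodd q hq) (hAQ q hq) Λ c hc
      haveI : NeZero q := ⟨(hQ q hq).ne_zero⟩
      rw [Submodule.coe_smul, HeckeRing0.smul_dual_apply, map_sub, HeckeRing0.toEnd_T, map_one, LinearMap.sub_apply, Module.End.one_apply, hG, add_sub_cancel_left, map_smul,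
        smul_eq_mul]
      have h : c * (2 * (y : Module.Dual ℂ (CuspForm (Gamma0 L) 2)) G) / 2 = c * (y : Module.Dual ℂ (CuspForm (Gamma0 L) 2)) G := by ring
      rw [h]
      exact hGint _ y.2
  · -- `0`
    intro y
    rw [zero_smul, Submodule.coe_zero, LinearMap.zero_apply, mul_zero, zero_div]
    exact Λ.zero_mem
  · -- `+`
    intro s₁ s₂ _ _ h₁ h₂ y
    rw [add_smul, Submodule.coe_add, LinearMap.add_apply, mul_add, add_div]
    exact Λ.add_mem (h₁ y) (h₂ y)
  · -- `r • s`
    intro r s _ hs y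
    rw [smul_eq_mul, show r * s = s * r from mul_comm r s, mul_smul]
    exact hs (r • y)

end Summit.BirchSwinnertonDyer.BirchSwinnertonDyer.Theorems.AlignedTransportAtTwoKilfordCopyCrossLevelOldLinesHeckeIdeal

end
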